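import Mathlib.RingTheory.FinitePresentation
import Mathlib.RingTheory.MvPolynomial.Localization
import Mathlib.RingTheory.TensorProduct.MvPolynomial
import HarnessLib

/-!
# Finitely presented algebras over a localization descend to the base ring

Let `A` be a commutative ring, `S ⊆ A` a submonoid, `B` a localization of `A` at `S` and `C` a
finitely presented `B`-algebra. Then `C` is the base change of a finitely presented `A`-algebra:
there is a finitely presented `A`-algebra `C₀` with `B ⊗[A] C₀ ≃ₐ[B] C`
(`exists_finitePresentation_tensorProduct_algEquiv`). This is the affine (and, for localizations,
stage-free) case of the principle that schemes of finite presentation over a limit `lim Sᵢ` come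
from a finite stage (EGA IV₃ Thm. 8.8.2 (ii); The Stacks project, Tag 01ZM): write
`C = B[X₁, …, Xₙ]/(p₁, …, pₘ)`; since `B[X]` is the localization of `A[X]` at `S`
(Mathlib `MvPolynomial.isLocalization`) every `pⱼ` is a unit multiple of the image of some
`qⱼ ∈ A[X]`, and `C₀ := A[X]/(q₁, …, qₘ)` works (`tensorProduct_quotient_algEquiv_of_ker`: for any
`A`-algebra `B`, `B ⊗[A] A[X]/I₀ ≃ B[X]/ker f` as soon as `I₀ B[X] = ker f`, by explicit mutually
inverse maps checked on generators). The consumer in this tree is the descent of schemes of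
finite presentation along `Spec A_S = lim Spec A[1/s]` (`Literature/AlgebraicGeometry/Limits/`),
used by the existence programme for Néron models.

Mathlib (pin) has the finite-presentation API (`Algebra.FinitePresentation`, `.quotient`,
`.mvPolynomial`), `MvPolynomial.isLocalization`, `IsLocalization.surj` and
`Algebra.TensorProduct.quotIdealMapEquivTensorQuot`, but no descent statement of this kind (grep
`FinitePresentation` in `Mathlib/RingTheory/Localization`: only `Away/AdjoinRoot`, `Free`);
`Mathlib.RingTheory.Extension.Presentation.Core` descends a presentation to a *subring*
containing the coefficients, which does not apply to a non-injective `A → A_S`.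

## References

* A. Grothendieck, EGA IV₃, Thm. 8.8.2 (ii) (Publ. Math. IHÉS 28, 1966). [EGAIV3]
* The Stacks project, Tag 01ZM. [StacksProject]
-/

noncomputable section

open TensorProduct

namespace Literature.RingTheory.Localization

universe u v w

variable {A : Type u} [CommRing A] (B : Type v) [CommRing B] [Algebra A B]
  (C : Type w) [CommRing C] [Algebra B C] [Algebra A C] [IsScalarTower A B C]

section General

variable {B C} {n : ℕ}

/-- For a `B`-algebra map `f : B[X] → C` (`B` an `A`-algebra), `f ∘ map = aeval (f ∘ X)` on
`A[X]`. [folklore] -/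
theorem aeval_eq_map_apply (f : MvPolynomial (Fin n) B →ₐ[B] C) (q : MvPolynomial (Fin n) A) :
    MvPolynomial.aeval (fun i => f (MvPolynomial.X i)) q =
      f (MvPolynomial.map (algebraMap A B) q) := by
  change (MvPolynomial.aeval fun i => f (MvPolynomial.X i)).toRingHom q =
    (f.toRingHom.comp (MvPolynomial.map (algebraMap A B))) q
  congr 1
  refine MvPolynomial.ringHom_ext (fun a => ?_) (fun i => ?_)
  · simp [IsScalarTower.algebraMap_apply A B C]
  · simp

/-- **Base change of a quotient of a polynomial ring.** Let `B` be an `A`-algebra,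
`f : B[X₁,…,Xₙ] → C` a surjective `B`-algebra map and `I₀ ⊆ A[X₁,…,Xₙ]` an ideal generating the
kernel of `f` (`I₀ ↦ 0` under `f ∘ map`, and `ker f ⊆ I₀ B[X]`). Then `B ⊗[A] A[X]/I₀ ≃ₐ[B] C`:
the maps `b ⊗ [q] ↦ b · f(q)` and `C = B[X]/ker f → B ⊗[A] A[X]/I₀`, `Xᵢ ↦ 1 ⊗ [Xᵢ]`, are
mutually inverse (checked on generators). [folklore] -/
theorem nonempty_tensorProduct_quotient_algEquiv (I₀ : Ideal (MvPolynomial (Fin n) A))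
    (f : MvPolynomial (Fin n) B →ₐ[B] C) (hf : Function.Surjective f)
    (h₁ : ∀ q ∈ I₀, f (MvPolynomial.map (algebraMap A B) q) = 0)
    (h₂ : RingHom.ker f.toRingHom ≤ I₀.map (MvPolynomial.map (algebraMap A B))) :
    Nonempty (B ⊗[A] (MvPolynomial (Fin n) A ⧸ I₀) ≃ₐ[B] C) := by
  -- the map `A[X]/I₀ → C`
  let g : MvPolynomial (Fin n) A →ₐ[A] C := MvPolynomial.aeval fun i => f (MvPolynomial.X i)
  have hg : ∀ q, g q = f (MvPolynomial.map (algebraMap A B) q) := aeval_eq_map_apply f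
  have hgI₀ : ∀ a ∈ I₀, g a = 0 := fun a ha => by rw [hg]; exact h₁ a ha
  let g₀ : (MvPolynomial (Fin n) A ⧸ I₀) →ₐ[A] C := Ideal.Quotient.liftₐ I₀ g hgI₀
  have hg₀ : ∀ q, g₀ (Ideal.Quotient.mk I₀ q) = g q := fun q => Ideal.Quotient.lift_mk I₀ _ _
  -- the map `B ⊗ A[X]/I₀ → C`
  let φ : B ⊗[A] (MvPolynomial (Fin n) A ⧸ I₀) →ₐ[B] C :=
    Algebra.TensorProduct.lift (Algebra.ofId B C) g₀ fun x y => Commute.all _ _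
  have hφ : ∀ (b : B) (q : MvPolynomial (Fin n) A), φ (b ⊗ₜ[A] Ideal.Quotient.mk I₀ q) =
      algebraMap B C b * f (MvPolynomial.map (algebraMap A B) q) := by
    intro b q
    simp only [φ, Algebra.TensorProduct.lift_tmul, hg₀, hg]
    rfl
  -- the map `B[X] → B ⊗ A[X]/I₀`
  let ψ' : MvPolynomial (Fin n) B →ₐ[B] B ⊗[A] (MvPolynomial (Fin n) A ⧸ I₀) :=
    MvPolynomial.aeval fun i => (1 : B) ⊗ₜ[A] Ideal.Quotient.mk I₀ (MvPolynomial.X i)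
  have hψ'map : ∀ q : MvPolynomial (Fin n) A,
      ψ' (MvPolynomial.map (algebraMap A B) q) = (1 : B) ⊗ₜ[A] Ideal.Quotient.mk I₀ q := by
    intro q
    change (ψ'.toRingHom.comp (MvPolynomial.map (algebraMap A B))) q =
      ((Algebra.TensorProduct.includeRight (R := A) (A := B)
        (B := MvPolynomial (Fin n) A ⧸ I₀)).toRingHom.comp (Ideal.Quotient.mk I₀)) q
    congr 1
    refine MvPolynomial.ringHom_ext (fun a => ?_) (fun i => ?_)
    · change ψ' (MvPolynomial.map (algebraMap A B) (MvPolynomial.C a)) =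
        (1 : B) ⊗ₜ[A] Ideal.Quotient.mk I₀ (MvPolynomial.C a)
      rw [MvPolynomial.map_C, MvPolynomial.algHom_C, Algebra.TensorProduct.algebraMap_apply,
        Algebra.algebraMap_self, RingHom.id_apply, ← MvPolynomial.algebraMap_eq,
        Ideal.Quotient.mk_algebraMap, Algebra.algebraMap_eq_smul_one,
        Algebra.algebraMap_eq_smul_one, TensorProduct.smul_tmul]
    · change ψ' (MvPolynomial.map (algebraMap A B) (MvPolynomial.X i)) =
        (1 : B) ⊗ₜ[A] Ideal.Quotient.mk I₀ (MvPolynomial.X i)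
      rw [MvPolynomial.map_X]
      exact MvPolynomial.aeval_X _ i
  have hψ'ker : ∀ p ∈ RingHom.ker f.toRingHom, ψ' p = 0 := by
    intro p hp
    have hp' : p ∈ I₀.map (MvPolynomial.map (algebraMap A B)) := h₂ hp
    rw [Ideal.map] at hp'
    refine (Ideal.span_le (I := RingHom.ker ψ'.toRingHom)).mpr ?_ hp'
    rintro _ ⟨q, hq, rfl⟩
    change ψ' (MvPolynomial.map (algebraMap A B) q) = 0
    rw [hψ'map, Ideal.Quotient.eq_zero_iff_mem.mpr hq, TensorProduct.tmul_zero]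
  -- the map `C → B ⊗ A[X]/I₀`
  let ψ : C →ₐ[B] B ⊗[A] (MvPolynomial (Fin n) A ⧸ I₀) :=
    (Ideal.Quotient.liftₐ (RingHom.ker f.toRingHom) ψ' hψ'ker).comp
      (Ideal.quotientKerAlgEquivOfSurjective hf).symm.toAlgHom
  have hψ : ∀ r, ψ (f r) = ψ' r := by
    intro r
    change Ideal.Quotient.liftₐ _ ψ' hψ'ker
      ((Ideal.quotientKerAlgEquivOfSurjective hf).symm (f r)) = _
    rw [Ideal.quotientKerAlgEquivOfSurjective_symm_apply]
    exact Ideal.Quotient.lift_mk _ _ _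
  -- `φ ∘ ψ = id`
  have hφψ' : φ.comp ψ' = f := by
    refine MvPolynomial.algHom_ext fun i => ?_
    simp only [AlgHom.comp_apply, ψ', MvPolynomial.aeval_X]
    rw [hφ, map_one, one_mul, MvPolynomial.map_X]
  have e₁ : φ.comp ψ = AlgHom.id B C := by
    ext c
    obtain ⟨r, rfl⟩ := hf c
    simp only [AlgHom.comp_apply, AlgHom.id_apply, hψ]
    exact congr($hφψ' r)
  -- `ψ ∘ φ = id`
  have e₂ : ψ.comp φ = AlgHom.id B _ := by
    refine Algebra.TensorProduct.ext (Subsingleton.elim _ _) ?_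
    refine Ideal.Quotient.algHom_ext A (MvPolynomial.algHom_ext fun i => ?_)
    simp only [AlgHom.comp_apply, AlgHom.restrictScalars_apply, Ideal.Quotient.mkₐ_eq_mk,
      Algebra.TensorProduct.includeRight_apply, AlgHom.id_apply]
    rw [hφ, map_one, one_mul, hψ, hψ'map]
  exact ⟨AlgEquiv.ofAlgHom φ ψ e₁ e₂⟩

end General

variable (S : Submonoid A)

section Numerators

variable {B} {n : ℕ}

/-- Every polynomial over the localization `B = A_S` is the image of a polynomial over `A` up to
a unit of `B` coming from `S` (Mathlib `MvPolynomial.isLocalization` and `IsLocalization.surj`):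
`p * C s = map q` with `s ∈ S`. [folklore] -/
theorem exists_mul_C_algebraMap_eq_map [IsLocalization S B] (p : MvPolynomial (Fin n) B) :
    ∃ (q : MvPolynomial (Fin n) A) (s : A), s ∈ S ∧
      p * MvPolynomial.C (algebraMap A B s) = MvPolynomial.map (algebraMap A B) q := by
  letI : Algebra (MvPolynomial (Fin n) A) (MvPolynomial (Fin n) B) :=
    MvPolynomial.algebraMvPolynomial
  obtain ⟨⟨q, ⟨d, hd⟩⟩, h⟩ :=
    IsLocalization.surj (Submonoid.map (MvPolynomial.C (σ := Fin n)) S) p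
  obtain ⟨s, hs, rfl⟩ := Submonoid.mem_map.mp hd
  refine ⟨q, s, hs, ?_⟩
  have h' : p * MvPolynomial.map (algebraMap A B) (MvPolynomial.C s) =
      MvPolynomial.map (algebraMap A B) q := h
  rwa [MvPolynomial.map_C] at h'

end Numerators

/-- **Finitely presented algebras over a localization are base changes of finitely presented
algebras over the base ring.** If `B` is a localization of `A` at `S` and `C` is a finitely
presented `B`-algebra, there is a finitely presented `A`-algebra `C₀` (in the universe of `A`)
with `B ⊗[A] C₀ ≃ₐ[B] C`. Proof: choose `C = B[X₁,…,Xₙ]/(p₁,…,pₘ)` and numerators `qⱼ ∈ A[X]`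
of the `pⱼ` (`exists_mul_C_algebraMap_eq_map`: `pⱼ · C sⱼ = map qⱼ`, `sⱼ ∈ S`); then
`C₀ = A[X]/(q₁,…,qₘ)` is finitely presented and `(qⱼ) B[X] = (pⱼ)` because the `C sⱼ` are units,
so `nonempty_tensorProduct_quotient_algEquiv` applies. This is the affine case of EGA IV₃ 8.8.2 (ii) /
Stacks 01ZM for the localization `A_S = colim_{s ∈ S} A[1/s]`, in the stage-free form special
to localizations. [cite: StacksProject, Tag 01ZM (affine case)] -/
theorem exists_finitePresentation_tensorProduct_algEquiv [IsLocalization S B]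
    [Algebra.FinitePresentation B C] :
    ∃ (C₀ : Type u) (_ : CommRing C₀) (_ : Algebra A C₀),
      Algebra.FinitePresentation A C₀ ∧ Nonempty (B ⊗[A] C₀ ≃ₐ[B] C) := by
  classical
  obtain ⟨n, f, hf, hker⟩ := Algebra.FinitePresentation.out (R := B) (A := C)
  obtain ⟨T, hT⟩ := hker
  -- numerators and denominators of the relations
  choose num den hden hnum using
    fun p : MvPolynomial (Fin n) B => exists_mul_C_algebraMap_eq_map (A := A) S p
  have hfg : (Ideal.span (num '' (T : Set (MvPolynomial (Fin n) B)))).FG := ⟨T.image num, by simp⟩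
  refine ⟨MvPolynomial (Fin n) A ⧸ Ideal.span (num '' (T : Set (MvPolynomial (Fin n) B))),
    inferInstance, inferInstance, Algebra.FinitePresentation.quotient hfg,
    nonempty_tensorProduct_quotient_algEquiv _ f hf ?_ ?_⟩
  · -- the numerators are relations
    have hkerT : ∀ p ∈ T, f p = 0 := fun p hp => by
      have : p ∈ RingHom.ker f.toRingHom := hT ▸ Ideal.subset_span hp
      exact this
    intro q hq
    refine (Ideal.span_le (I := RingHom.ker
      (f.toRingHom.comp (MvPolynomial.map (algebraMap A B))))).mpr ?_ hq
    rintro _ ⟨p, hp, rfl⟩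
    change f (MvPolynomial.map (algebraMap A B) (num p)) = 0
    rw [← hnum, map_mul, hkerT p hp, zero_mul]
  · -- the relations lie in the ideal generated by the numerators (the denominators are units)
    rw [← hT]
    refine Ideal.span_le.mpr fun p hp => ?_
    have hu : IsUnit (MvPolynomial.C (σ := Fin n) (algebraMap A B (den p))) :=
      (IsLocalization.map_units B ⟨den p, hden p⟩).map MvPolynomial.C
    obtain ⟨c, hc⟩ := hu.exists_right_inv
    have hmem : MvPolynomial.map (algebraMap A B) (num p) ∈
        (Ideal.span (num '' (T : Set (MvPolynomial (Fin n) B)))).map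
          (MvPolynomial.map (algebraMap A B)) :=
      Ideal.mem_map_of_mem _ (Ideal.subset_span ⟨p, hp, rfl⟩)
    have : p = MvPolynomial.map (algebraMap A B) (num p) * c := by
      rw [← hnum, mul_assoc, hc, mul_one]
    rw [SetLike.mem_coe, this]
    exact Ideal.mul_mem_right _ _ hmem

end Literature.RingTheory.Localization

end
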